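import Summits.BirchSwinnertonDyer.BirchSwinnertonDyer.Theorems.KolyvaginRoadThreePTDevissageTrivialHE
import HarnessLib

/-!
# Dévissage of Milne I Thm. 4.10(b) — the UNIPOTENT INSTANCE modulo the two `H¹_{𝓤_S^*}`-vanishings

For a number field `K : Type` containing a primitive `p`-th root of unity (`p` odd or `K` totally complex)
and a short exact sequence `0 → A →(f) M →(g) B → 0` of finite discrete `p`-torsion `Γ_K`-modules with
`A`, `B` TRIVIAL of order `p` (a 2-dimensional unipotent `𝔽ₚ`-module, e.g. `E[p]` over the fixed field
of a `p`-Sylow of `Gal(K(E[p])/K)`): Milne I Thm. 4.10(b) `Ker γ¹ ⊆ Im β¹` for `M` and THE invariant maps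
at an admissible `S` follows from the dévissage `middleExact_canonical_of_extension` with EVERY input
discharged by the tree — `hE` of the trivial pieces and their duals (`middleExact_canonical_of_trivial_of_card_eq`),
`Ш²(K, A) = Ш²(K, B^D) = 0` (`sha_two_eq_zero_of_trivial_of_card_eq`, `sha_two_tateDual_eq_zero_…`,
Brauer–Hasse–Noether) — EXCEPT the two vanishings `H¹_{𝓤_S^*}(K, A^D) = 0`, `H¹_{𝓤_S^*}(K, B^{DD}) = 0`
(classes trivial on `S` and unramified off `S`; true for all large `S` by finiteness of the
everywhere-unramified classes + `Ш¹(K, μₚ) = 0`, not yet in the tree in this currency — kept as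
hypotheses `hH₁`, `hH₃D`).  Theorems only; no case of BSD.

References: [MilneADT2006] I Thm. 4.10(b); [CasselsFrohlichANT1967] VII §9.6.
-/

noncomputable section

open CategoryTheory Function NumberField IsDedekindDomain
open scoped NumberField ContRepresentation

set_option linter.dupNamespace false
set_option autoImplicit false

namespace Summit.BirchSwinnertonDyer.BirchSwinnertonDyer.Theorems.KolyvaginRoadThreePT

open Field
open Literature.NumberTheory.GaloisRepresentations Literature.NumberTheory.GaloisCohomology
open Literature.NumberTheory.GaloisRepresentations.DiscreteGaloisModule (mu MuCarrier TateDual tateDual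
  localTatePairingZMod homOfIntertwining unramifiedSubgroup)
open Summit.BirchSwinnertonDyer.BirchSwinnertonDyer.Theorems.SchneiderFreeAdditiveX3.PoitouTateReduction

variable {K : Type} [Field K] [NumberField K] {p : ℕ} [hp : Fact p.Prime]
variable {A M B : Type}
  [AddCommGroup A] [TopologicalSpace A] [DiscreteTopology A] [Finite A]
  [AddCommGroup M] [TopologicalSpace M] [DiscreteTopology M] [Finite M]
  [AddCommGroup B] [TopologicalSpace B] [DiscreteTopology B] [Finite B]

omit [Finite A] in
/-- A trivial module is unramified everywhere. [folklore] -/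
theorem isUnramifiedAt_of_trivial (ρA : DiscreteGaloisModule K A)
    (hA : ∀ (σ : absoluteGaloisGroup K) (a : A), ρA σ a = a) (v : HeightOneSpectrum (𝓞 K)) :
    GaloisRep.IsUnramifiedAt v ρA := by
  rw [GaloisRep.isUnramifiedAt_iff_toLocal_holds]
  intro σ _
  refine DFunLike.ext _ _ fun a => ?_
  exact hA _ a

/-- **Milne I Thm. 4.10(b) for a 2-dimensional UNIPOTENT `𝔽ₚ`-module over `K ∋ μₚ`, modulo the two
`H¹_{𝓤_S^*}`-vanishings** (see the module docstring). [cite: MilneADT2006, Ch. I, Thm. 4.10(b)] -/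
theorem middleExact_canonical_of_unipotentTwo [Finite (TateDual K B p)] (harch : ∀ w : InfinitePlace K, w.IsReal → Odd p)
    {ζ : K} (hζ : IsPrimitiveRoot ζ p)
    (ρA : DiscreteGaloisModule K A) (ρ : DiscreteGaloisModule K M) (ρB : DiscreteGaloisModule K B)
    (hA : ∀ (σ : absoluteGaloisGroup K) (a : A), ρA σ a = a)
    (hB : ∀ (σ : absoluteGaloisGroup K) (b : B), ρB σ b = b)
    (hcardA : Nat.card A = p) (hcardB : Nat.card B = p)
    (hpA : ∀ a : A, p • a = 0) (hpM : ∀ m : M, p • m = 0) (hpB : ∀ b : B, p • b = 0)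
    {f : ρA.toContRepresentation →ⁱL ρ.toContRepresentation}
    {g : ρ.toContRepresentation →ⁱL ρB.toContRepresentation}
    (h : IsSES (homOfIntertwining f) (homOfIntertwining g))
    {S : Finset (Place K)} (hSinf : ∀ w : InfinitePlace K, (Sum.inl w : Place K) ∈ S)
    (hS : ∀ v : HeightOneSpectrum (𝓞 K), (Sum.inr v : Place K) ∉ S →
      ((p : ℕ) : 𝓞 K) ∉ v.asIdeal ∧ GaloisRep.IsUnramifiedAt v ρ)
    (hH₁ : ∀ y : galoisCohomology (ρA.tateDual p) 1,
      (∀ v ∈ S, galoisCohomology.localization (ρA.tateDual p) v 1 y = 0) →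
      (∀ v : HeightOneSpectrum (𝓞 K), (Sum.inr v : Place K) ∉ S →
        galoisCohomology.localization (ρA.tateDual p) (Sum.inr v) 1 y ∈
          unramifiedSubgroup (GaloisRep.toLocal v (ρA.tateDual p)) 1) → y = 0)
    (hH₃D : ∀ y : galoisCohomology ((ρB.tateDual p).tateDual p) 1,
      (∀ v ∈ S, galoisCohomology.localization ((ρB.tateDual p).tateDual p) v 1 y = 0) →
      (∀ v : HeightOneSpectrum (𝓞 K), (Sum.inr v : Place K) ∉ S →
        galoisCohomology.localization ((ρB.tateDual p).tateDual p) (Sum.inr v) 1 y ∈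
          unramifiedSubgroup (GaloisRep.toLocal v ((ρB.tateDual p).tateDual p)) 1) → y = 0)
    (t : Π v : Place K, galoisCohomology (ρ.toLocal v) 1)
    (horth : ∀ y : galoisCohomology (ρ.tateDual p) 1,
      (∀ v : HeightOneSpectrum (𝓞 K), (Sum.inr v : Place K) ∉ S →
        galoisCohomology.localization (ρ.tateDual p) (Sum.inr v) 1 y ∈
          unramifiedSubgroup (GaloisRep.toLocal v (ρ.tateDual p)) 1) →
      ∑ v ∈ S, localTatePairingZMod ρ p v (LocalInvariants.canonical K p v) (t v)
        (galoisCohomology.localization (ρ.tateDual p) v 1 y) = 0) :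
    ∃ x : galoisCohomology ρ 1,
      (∀ v : HeightOneSpectrum (𝓞 K), (Sum.inr v : Place K) ∉ S →
        galoisCohomology.localization ρ (Sum.inr v) 1 x ∈ unramifiedSubgroup (GaloisRep.toLocal v ρ) 1) ∧
      ∀ v ∈ S, galoisCohomology.localization ρ v 1 x = t v := by
  haveI : NeZero p := ⟨hp.out.ne_zero⟩
  have hμ : ∀ (σ : absoluteGaloisGroup K) (w : MuCarrier K p), mu K p σ w = w :=
    mu_apply_eq_self_of_isPrimitiveRoot K hζ
  -- the dual maps
  obtain ⟨gD, hgD⟩ := exists_tateDual_precomp_intertwining p g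
  obtain ⟨fD, hfD⟩ := exists_tateDual_precomp_intertwining p f
  -- `B^D` is trivial of order `p`
  have hBD : ∀ (σ : absoluteGaloisGroup K) (φ : TateDual K B p), ρB.tateDual p σ φ = φ :=
    tateDual_apply_eq_self_of_trivial p ρB hB hμ
  have hcardBD : Nat.card (TateDual K B p) = p := (HomCarrier.natCard_eq (muEquivZMod K p) hpB).trans hcardB
  -- unramifiedness of the pieces
  have hS' : ∀ v : HeightOneSpectrum (𝓞 K), (Sum.inr v : Place K) ∉ S →
      ((p : ℕ) : 𝓞 K) ∉ v.asIdeal ∧ GaloisRep.IsUnramifiedAt v ρA ∧ GaloisRep.IsUnramifiedAt v ρ ∧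
        GaloisRep.IsUnramifiedAt v ρB := fun v hv =>
    ⟨(hS v hv).1, isUnramifiedAt_of_trivial ρA hA v, (hS v hv).2, isUnramifiedAt_of_trivial ρB hB v⟩
  refine middleExact_canonical_of_extension h hpA hpM gD hgD fD hfD hSinf hS'
    (fun S' hSS' t' horth' => middleExact_canonical_of_trivial_of_card_eq harch ρA hA hcardA S'
      (fun w => hSS' (hSinf w)) (fun v hv => (hS v fun h' => hv (hSS' h')).1) t' horth')
    (fun t' horth' => middleExact_canonical_of_trivial_of_card_eq harch ρB hB hcardB S hSinf
      (fun v hv => (hS v hv).1) t' horth')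
    (fun S' hSS' t' horth' => middleExact_canonical_of_trivial_of_card_eq harch (ρB.tateDual p) hBD hcardBD
      S' (fun w => hSS' (hSinf w)) (fun v hv => (hS v fun h' => hv (hSS' h')).1) t' horth')
    (sha_two_eq_zero_of_trivial_of_card_eq hζ ρA hA hcardA)
    (sha_two_tateDual_eq_zero_of_trivial_of_card_eq hζ ρB hB hpB hcardB) hH₁ hH₃D t horth

end Summit.BirchSwinnertonDyer.BirchSwinnertonDyer.Theorems.KolyvaginRoadThreePT

end
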